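import Summits.HodgeConjecture.HodgeConjecture.Theses.HolomorphicityRate
import Literature.AlgebraicGeometry.HodgeTheory.AnalyticSupport
import Literature.AlgebraicGeometry.HodgeTheory.GAGADimensionProofs
import HarnessLib

/-!
# Route `HolomorphicityRate`, item `AnalyticSupportAlgebraic` (stmt-HodgeConjecture-2741)

Chow/GAGA glue of the route: a class `c ∈ H²ᵖ(X(ℂ); ℂ)` on a smooth projective `X` whose pull-back
to a Hodge model `A` dies off a closed analytic subset `S ⊆ X^an` all of whose regular points have
codimension `≥ p` lies in `algebraicClasses X p = Nᵖ H²ᵖ`.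

The route decl is, up to currying, the statement of
`Literature.AlgebraicGeometry.HodgeTheory.IsAnalyticallySupported.mem_algebraicClasses`
(file `HodgeTheory/AnalyticSupport`: Chow's theorem for analytifications
`chow_analyticSet_analytification_holds`, transport of the vanishing
`restrictCompl_eq_zero_of_pullback`, and `mem_supportedClasses_of_restrictCompl_eq_zero`), which is
conditional on the GAGA dimension comparison `gaga_le_coheight_of_regularLocus_codim`
(Serre, GAGA §6 Prop. 3 Cor. 2–3); that named fact is discharged in the tree by
`gaga_le_coheight_of_regularLocus_codim_holds` (file `HodgeTheory/GAGADimensionProofs`), so the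
item closes unconditionally.

## References

* J.-P. Serre, *Géométrie algébrique et géométrie analytique*, Ann. Inst. Fourier 6 (1956), §6
  Prop. 3 Cor. 2–3, §19 Prop. 13 [SerreGAGA1956].
* W.-L. Chow, On compact complex analytic varieties, Amer. J. Math. 71 (1949), Thm. V [Chow1949].
* C. Voisin, *Hodge Theory and Complex Algebraic Geometry I* (CUP 2002), §11.1 [VoisinHodgeI2002].
-/

noncomputable section

open scoped Manifold

-- `Summit.HodgeConjecture.HodgeConjecture.Theorems` is the mandated namespace (single-problem summit:
-- Problem = Summit), which `linter.dupNamespace` flags on every declaration; the lakefile turns the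
-- linter off tree-wide (weak option), restated here so stand-alone elaboration is warning-free too.
set_option linter.dupNamespace false

namespace Summit.HodgeConjecture.HodgeConjecture.Theorems

open Literature.AlgebraicGeometry.HodgeTheory

/-- **`AnalyticSupportAlgebraic` holds** (item stmt-HodgeConjecture-2741 of route
`HolomorphicityRate`): for `X` smooth projective of dimension `n` over `ℂ`, a Hodge model `A`,
`c ∈ H²ᵖ(X(ℂ); ℂ)` and a closed analytic `S ⊆ A.carrier` all of whose regular points have
codimension `≥ p`, if `A.pullback (2p) c` restricts to `0` on `A.carrier ∖ S` then
`c ∈ algebraicClasses X p`. Proof: the hypotheses say `IsAnalyticallySupported A p c`; apply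
`IsAnalyticallySupported.mem_algebraicClasses` (Chow + GAGA) with the discharged GAGA dimension
comparison `gaga_le_coheight_of_regularLocus_codim_holds`. -/
theorem analyticSupportAlgebraic_proof :
    Summit.HodgeConjecture.HodgeConjecture.Theses.HolomorphicityRate.AnalyticSupportAlgebraic := by
  unfold Summit.HodgeConjecture.HodgeConjecture.Theses.HolomorphicityRate.AnalyticSupportAlgebraic
  intro n p X hX A c S hS hcS
  exact IsAnalyticallySupported.mem_algebraicClasses gaga_le_coheight_of_regularLocus_codim_holds hX
    ⟨S, hS, hcS⟩

end Summit.HodgeConjecture.HodgeConjecture.Theorems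

end
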